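import Summits.ResolutionOfSingularities.ResolutionOfSingularities.Theorems.PAlterationPialtProjective
import Literature.AlgebraicGeometry.Resolution.AlterationsNormalizationReduction
import Literature.AlgebraicGeometry.Motives.ProjectiveOfGeneratingSections
import HarnessLib

/-!
# `Pialt` (crux stmt-ResolutionOfSingularities-0555): reduction to normal projective varieties

Companion to `PAlterationPialtProjective.lean` (`pialt_iff_forall_isProjectiveOver`: Chow's lemma
and projective closure) and `PAlterationPialtReductions.lean` (`pialt_iff_forall_normal`:
normalise first), landed `--supports stmt-ResolutionOfSingularities-0555` (does not close the item).
The two reductions COMBINE: **`Pialt` is equivalent to its restriction to NORMAL PROJECTIVE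
varieties** — the normalisation `X'^ν → X'` of a projective variety is finite (E. Noether), and a
proper `k`-scheme finite over `ℙⁿ_k` is projective (Görtz–Wedhorn I, Thm. 13.84 with Cor. 13.72,
in tree as `Motives.isProjectiveOver_of_isFinite`), so `X'^ν` is a normal projective variety
(`isProjectiveOver_normalization`); the conclusion of `Pialt` descends along the purely
inseparable alteration `X'^ν → X'`. Hence a counterexample to `Pialt`, if any, may be taken to be
a normal projective variety (of dimension `≥ 4`, by the known cases).

Sources: A. J. de Jong, Publ. Math. IHÉS 83 (1996), 4.6–4.7, 4.16; U. Görtz, T. Wedhorn,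
*Algebraic Geometry I*, 2nd ed., Thm. 13.84, Cor. 13.72; Stacks Project, Tags 02O2, 035Q.
-/

noncomputable section

set_option linter.dupNamespace false -- mandated namespace of this single-conjunct summit

namespace Summit.ResolutionOfSingularities.ResolutionOfSingularities.Theorems

open CategoryTheory AlgebraicGeometry TopologicalSpace
open Literature.AlgebraicGeometry.Resolution Literature.AlgebraicGeometry
open Summit.ResolutionOfSingularities.ResolutionOfSingularities.Theses.PAlteration (Pialt)

/-- **The normalisation of a projective variety is projective** (de Jong 1996, 4.16 with
`L = K(X)`): `X^ν → X ↪ ℙⁿ_k` is finite (E. Noether, `isFinite_normalizationι`), `X^ν` is proper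
over `k`, and a proper `k`-scheme finite over `ℙⁿ_k` is projective
(`Motives.isProjectiveOver_of_isFinite`). [cite: DeJong1996, 4.16, p. 71] -/
theorem isProjectiveOver_normalization {k : Type} [Field k] (X : Scheme.{0}) [IsIntegral X]
    (f : X ⟶ Spec (.of k)) (hproj : Motives.IsProjectiveOver (Over.mk f)) :
    Motives.IsProjectiveOver (Over.mk (normalizationι X ≫ f)) := by
  haveI : IsProper f := Motives.IsProjectiveOver.isProper hproj
  obtain ⟨n, ι, hι⟩ := hproj
  -- the closed immersion `X ↪ ℙⁿ_k`, retyped with source `X`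
  let ι' : X ⟶ (Motives.projectiveSpace n k).left := ι.left
  haveI : IsClosedImmersion ι' := hι
  have hf : ι' ≫ (Motives.projectiveSpace n k).hom = f := Over.w ι
  haveI : IsFinite (normalizationι X) :=
    isFinite_normalizationι X NoetherFiniteIntegralClosure_holds f
  haveI : IsProper (Over.mk (normalizationι X ≫ f) : Motives.SchemeOver k).hom :=
    inferInstanceAs (IsProper (normalizationι X ≫ f))
  have hw : (normalizationι X ≫ ι') ≫ (Motives.projectiveSpace n k).hom =
      (Over.mk (normalizationι X ≫ f) : Motives.SchemeOver k).hom := by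
    rw [Category.assoc, hf]
    rfl
  haveI : IsFinite (Over.homMk (normalizationι X ≫ ι') hw :
      (Over.mk (normalizationι X ≫ f) : Motives.SchemeOver k) ⟶ Motives.projectiveSpace n k).left :=
    inferInstanceAs (IsFinite (normalizationι X ≫ ι'))
  exact Motives.isProjectiveOver_of_isFinite (Over.homMk (normalizationι X ≫ ι') hw)

/-- **The conclusion of `Pialt` for one variety follows from `Pialt` for normal projective
varieties over the same field**: reduce to projective `X'` (`pialtConclusion_of_forall_isProjectiveOver`),
then to its normalisation `X'^ν`, which is normal (`isIntegrallyClosed_stalk_normalization`),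
integral and projective (`isProjectiveOver_normalization`), and descend along `X'^ν → X'`
(`isPurelyInseparableAlteration_normalizationι`). [cite: DeJong1996, 4.6–4.7, 4.16] -/
theorem pialtConclusion_of_forall_normal_isProjectiveOver {k : Type} [Field k] {X : Scheme.{0}}
    (f : X ⟶ Spec (.of k)) [IsSeparated f] [LocallyOfFiniteType f] [QuasiCompact f] [IsIntegral X]
    (H : ∀ (X' : Scheme.{0}) (f' : X' ⟶ Spec (.of k)), IsIntegral X' →
      Motives.IsProjectiveOver (Over.mk f') →
        (∀ x : X', IsIntegrallyClosed (X'.presheaf.stalk x)) →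
          ∃ (Y : Scheme.{0}) (g : Y ⟶ X'), IsProper g ∧ IsIntegral Y ∧ Scheme.IsRegular Y ∧
            Function.Surjective g.base ∧ ∃ U : X'.Opens, Dense (U : Set X') ∧ IsFinite (g ∣_ U) ∧
              UniversallyInjective (g ∣_ U)) :
    ∃ (Y : Scheme.{0}) (g : Y ⟶ X), IsProper g ∧ IsIntegral Y ∧ Scheme.IsRegular Y ∧
      Function.Surjective g.base ∧ ∃ U : X.Opens, Dense (U : Set X) ∧ IsFinite (g ∣_ U) ∧
        UniversallyInjective (g ∣_ U) := by
  refine pialtConclusion_of_forall_isProjectiveOver f fun X' f' hi' hproj => ?_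
  haveI := hi'
  haveI : IsProper f' := Motives.IsProjectiveOver.isProper hproj
  haveI : IsFinite (normalizationι X') :=
    isFinite_normalizationι X' NoetherFiniteIntegralClosure_holds f'
  refine pialtConclusion_of_isPurelyInseparableAlteration
    (isPurelyInseparableAlteration_normalizationι X' f') ?_
  exact H (normalization X') (normalizationι X' ≫ f') inferInstance
    (isProjectiveOver_normalization X' f' hproj) (isIntegrallyClosed_stalk_normalization X')

/-- **Reduction of `Pialt` to normal projective varieties**: `Pialt` holds if and only if, for
every prime `p`, every field `k` of characteristic `p` and every NORMAL integral PROJECTIVE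
`k`-scheme `X` (closed `k`-immersion into some `ℙⁿ_k`), there is a proper surjective `g : X' → X`
with `X'` integral regular, finite and universally injective over a dense open of `X` — Chow's
lemma, projective closure, normalisation (`pialtConclusion_of_forall_normal_isProjectiveOver`).
[cite: DeJong1996, 4.6–4.7, 4.16] -/
theorem pialt_iff_forall_normal_isProjectiveOver :
    Pialt ↔ ∀ p : ℕ, p.Prime → ∀ (k : Type) [Field k] [CharP k p] (X : Scheme.{0})
      (f : X ⟶ Spec (.of k)), IsIntegral X → Motives.IsProjectiveOver (Over.mk f) →
        (∀ x : X, IsIntegrallyClosed (X.presheaf.stalk x)) →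
          ∃ (X' : Scheme.{0}) (g : X' ⟶ X), IsProper g ∧ IsIntegral X' ∧ Scheme.IsRegular X' ∧
            Function.Surjective g.base ∧ ∃ U : X.Opens, Dense (U : Set X) ∧ IsFinite (g ∣_ U) ∧
              UniversallyInjective (g ∣_ U) := by
  refine ⟨fun h p hp k _ _ X f hi hproj _ => ?_, fun h => ?_⟩
  · unfold Pialt at h
    haveI : IsProper f := Motives.IsProjectiveOver.isProper hproj
    exact h p hp k X f inferInstance inferInstance inferInstance hi
  · unfold Pialt
    intro p hp k _ _ X f hs hl hq hi
    haveI := hs; haveI := hl; haveI := hq; haveI := hi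
    exact pialtConclusion_of_forall_normal_isProjectiveOver f fun X' f' hi' hproj hN' =>
      h p hp k X' f' hi' hproj hN'

end Summit.ResolutionOfSingularities.ResolutionOfSingularities.Theorems

end
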